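import Literature.Geometry.Lorentzian.DevelopmentGaussianChart
import Literature.Geometry.Lorentzian.CoordKillingDevelopment
import Literature.Geometry.Lorentzian.LocalConstraintDeformationReduction
import HarnessLib

/-!
# KIDs are initial data of Killing fields: the Moncrief half of
# `ChruscielDelay_localConstraintDeformation`

This file discharges the coordinate core `(M)` of
`ChruscielDelay_localConstraintDeformation_of_coordCore` (`LocalConstraintDeformationReduction.lean`):
**if the vacuum development of `D` has no non-trivial Killing field near `ι x₀` vanishing on the
data hypersurface, then the chart readings of `D` admit no KIDs on small chart balls around
`c x₀`** (Moncrief, J. Math. Phys. 16 (1975), §III: KIDs are precisely the Cauchy data of the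
Killing fields of the vacuum development; Fischer–Marsden–Moncrief 1980, Lemma 2.2;
Chruściel–Delay 2003, §1, the "no KIDs" hypothesis of Thm. 5.9).

Proof (`ChruscielDelay_noKID_of_noKilling`). Read the development in the second-order Gaussian
chart `Φ` at `ι x₀` (`DevelopmentGaussianChart.lean`: components `G = Φ^* g` on the Gaussian domain,
a Gaussian slice along `{0} × B₀` whose slice data are the chart readings of `D`, vacuum
`Ric(G) = 0`, slice-hyperbolic); the KID equations and the vacuum constraints for the chart
readings are those of the slice data (locality, `CoordConstraintCongr.lean`); the coordinate
theorem `GaussSlice.exists_coordKilling_of_kid` (`CoordKillingDevelopment.lean`: wave equation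
for `Θ` with KID Cauchy data, vanishing of the Cauchy data of the Killing defect, hyperbolic
uniqueness) produces a solution `ξ̃ = Θ♯` of the coordinate Killing equation on an open set
`W₀ ⊇ {0} × ball` on which `Φ` is injective (`Set.InjOn.exists_isOpen_superset`); it is transported
to a Killing field `ξ` of `g` on the open set `Φ(W₀) ⊇ ι(c⁻¹(ball))`
(`ImmersionChart.exists_killing_of_coord`), which vanishes on the hypersurface by hypothesis; hence
`Θ = 0` on the slice, i.e. `N = 0`, `Y = 0`. The file ends with
`ChruscielDelay_localConstraintDeformation_of_coordCoreA`: the fact follows from the remaining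
analytic core `(A)` alone (Chruściel–Delay 2003, Thm. 5.9 / Prop. 5.10 / Cor. 5.11 in coordinates).

Everything is proved; no definitions, no named facts (D-0026).

## References

* V. Moncrief, J. Math. Phys. 16 (1975) 493–498, §III. [Moncrief1975]
* A. E. Fischer, J. E. Marsden, V. Moncrief, Ann. Inst. H. Poincaré A 33 (1980), Lemma 2.2.
  [FischerMarsdenMoncrief1980]
* P. T. Chruściel, E. Delay, Mém. Soc. Math. Fr. 94 (2003), §1 and Thm. 5.9, Prop. 5.10,
  Cor. 5.11. [ChruscielDelay2003]
-/

noncomputable section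

set_option maxSynthPendingDepth 3

open Bundle Set Function Filter TopologicalSpace Manifold Module Metric
open scoped Manifold ContDiff Topology

namespace Literature.Geometry.Lorentzian

open MetricCoord MetricCoord.GaussSlice DataEmbedding

/-- **KIDs are initial data of Killing fields** (Moncrief 1975, §III), in the form of hypothesis
`(M)` of `ChruscielDelay_localConstraintDeformation_of_coordCore`: see the module docstring.
[cite: Moncrief1975, §III] [cite: FischerMarsdenMoncrief1980, Lemma 2.2] -/
theorem ChruscielDelay_noKID_of_noKilling :
    ∀ (X : Type) [TopologicalSpace X] [ChartedSpace E3 X] [IsManifold (𝓡 3) ∞ X]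
      [T2Space X] [SecondCountableTopology X] [ConnectedSpace X]
      (D : InitialDataSet (𝓡 3) X) (𝒟 : VacuumCauchyDevelopment D) (x₀ : X),
      (∀ [D.metric.HasLeviCivita], D.IsVacuumConstraintSolution) →
      (haveI : 𝒟.metric.toPseudoRiemannianMetric.HasLeviCivita := 𝒟.metric.hasLeviCivita
        ∀ V : Set X, IsOpen V → IsConnected V → x₀ ∈ V →
          ∀ W : Set 𝒟.carrier, IsOpen W → 𝒟.embed '' V ⊆ W →
            ∀ ξ : (p : 𝒟.carrier) → TangentSpace (𝓡 4) p,
              ContMDiffOn (𝓡 4) ((𝓡 4).prod 𝓘(ℝ, E4)) ∞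
                (fun p ↦ (Bundle.TotalSpace.mk' E4 p (ξ p) : TangentBundle (𝓡 4) 𝒟.carrier)) W →
              (∀ p ∈ W, ∀ Y₀ Z₀ : TangentSpace (𝓡 4) p,
                𝒟.metric.val p (𝒟.metric.toPseudoRiemannianMetric.leviCivita ξ p Y₀) Z₀ +
                  𝒟.metric.val p Y₀ (𝒟.metric.toPseudoRiemannianMetric.leviCivita ξ p Z₀) = 0) →
              ∀ x ∈ V, ξ (𝒟.embed x) = 0) →
      ∃ ρ₀ : ℝ, 0 < ρ₀ ∧ closedBall (chartAt E3 x₀ x₀) ρ₀ ⊆ (chartAt E3 x₀).target ∧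
        ∀ ρ : ℝ, 0 < ρ → ρ ≤ ρ₀ →
          ∀ (N : E3 → ℝ) (Y : E3 → E3),
            ContDiffOn ℝ ∞ N (ball (chartAt E3 x₀ x₀) ρ) →
            ContDiffOn ℝ ∞ Y (ball (chartAt E3 x₀ x₀) ρ) →
            (∀ z ∈ ball (chartAt E3 x₀ x₀) ρ,
              MetricCoord.adjHamG (D.comap _ (ChartInverse.contMDiff_symm x₀) (ChartInverse.injective_mfderiv_symm x₀)).coordHOn (D.comap _ (ChartInverse.contMDiff_symm x₀) (ChartInverse.injective_mfderiv_symm x₀)).coordKOn N z + MetricCoord.adjMomGS (D.comap _ (ChartInverse.contMDiff_symm x₀) (ChartInverse.injective_mfderiv_symm x₀)).coordHOn (D.comap _ (ChartInverse.contMDiff_symm x₀) (ChartInverse.injective_mfderiv_symm x₀)).coordKOn Y z = 0 ∧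
              MetricCoord.adjHamK (D.comap _ (ChartInverse.contMDiff_symm x₀) (ChartInverse.injective_mfderiv_symm x₀)).coordHOn (D.comap _ (ChartInverse.contMDiff_symm x₀) (ChartInverse.injective_mfderiv_symm x₀)).coordKOn N z + MetricCoord.adjMomKS (D.comap _ (ChartInverse.contMDiff_symm x₀) (ChartInverse.injective_mfderiv_symm x₀)).coordHOn Y z = 0) →
            ∀ z ∈ ball (chartAt E3 x₀ x₀) ρ, N z = 0 ∧ Y z = 0 := by
  intro X _ _ _ _ _ _ D 𝒟 x₀ hcons hKID
  haveI hLC : 𝒟.metric.toPseudoRiemannianMetric.HasLeviCivita := 𝒟.metric.hasLeviCivita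
  set 𝒮 : DataEmbedding D := 𝒟.toDataEmbedding with h𝒮_def
  set c := chartAt E3 x₀ with hc_def
  set D' := D.comap _ (ChartInverse.contMDiff_symm x₀) (ChartInverse.injective_mfderiv_symm x₀)
    with hD'_def
  -- an identification `E4 ≃ ℝ × E3`
  set cs : E4 ≃L[ℝ] ℝ × E3 := ContinuousLinearEquiv.ofFinrankEq finrank_prod_eq.symm with hcs_def
  -- the Gaussian chart data
  set G := gcG 𝒮 x₀ cs with hG_def
  set T := gcDom 𝒮 x₀ cs with hT_def
  set B := gcB₀ 𝒮 x₀ with hB_def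
  have hG : IsMetricOn G T := isMetricOn_gcG 𝒮 x₀ cs
  have hB : IsOpen B := isOpen_gcB₀ 𝒮 x₀
  have hBT : ∀ y ∈ B, svec y ∈ T := fun y hy ↦ svec_mem_gcDom 𝒮 x₀ cs hy
  have hS : IsGaussianSlice G B := isGaussianSlice_gcG 𝒮 x₀ cs
  have hvac : 𝒮.IsVacuum := fun {_} ↦ 𝒟.isRicciFlat
  have hRic : ∀ p ∈ T, ricAt G p = 0 := fun p hp ↦
    ContinuousLinearMap.ext fun Y₀ ↦ ContinuousLinearMap.ext fun Z₀ ↦ ricAt_gcG_eq_zero 𝒮 x₀ cs hvac hp Y₀ Z₀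
  have hpos : ∀ y ∈ B, ∀ v : E3, v ≠ 0 → 0 < sliceMetric G y v v := fun y hy v hv ↦
    sliceMetric_gcG_pos 𝒮 x₀ cs hy hv
  -- the slice data are the chart readings of `D` near every point of `B`
  have hcB : ∀ y ∈ B, y ∈ c.target := fun y hy ↦ hy.1
  have hmf : ∀ {y : E3} (hy : y ∈ c.target) (v : E3),
      mfderiv 𝓘(ℝ, E3) (𝓡 3)
        (fun u : (⟨c.target, c.open_target⟩ : Opens E3) ↦ c.symm u) ⟨y, hy⟩ v =
      mfderiv 𝓘(ℝ, E3) (𝓡 3) c.symm y v := fun {y} hy v ↦ by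
    have hd : MDifferentiableAt 𝓘(ℝ, E3) (𝓡 3) c.symm y :=
      (mdifferentiable_chart (I := 𝓡 3) x₀).mdifferentiableAt_symm hy
    have h := mfderiv_comp_subtypeVal (W := (⟨c.target, c.open_target⟩ : Opens E3)) (f := c.symm)
      (y := ⟨y, hy⟩) hd
    exact congrArg (fun L : E3 →L[ℝ] TangentSpace (𝓡 3) (c.symm y) ↦ L v) h
  have hHpt : ∀ y ∈ B, sliceMetric G y = D'.coordHOn y := fun y hy ↦ by
    ext v w
    rw [InitialDataSet.coordHOn_of_mem D' (hcB y hy), sliceMetric_gcG 𝒮 x₀ cs hy]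
    change _ = (D.comap _ (ChartInverse.contMDiff_symm x₀) (ChartInverse.injective_mfderiv_symm x₀)).h.inner
      ⟨y, hcB y hy⟩ v w
    rw [InitialDataSet.comap_h_inner, hmf (hcB y hy), hmf (hcB y hy)]
  have hKpt : ∀ y ∈ B, sliceK G y = D'.coordKOn y := fun y hy ↦ by
    ext v w
    rw [InitialDataSet.coordKOn_of_mem D' (hcB y hy), sliceK_gcG 𝒮 x₀ cs hy]
    change _ = (D.comap _ (ChartInverse.contMDiff_symm x₀) (ChartInverse.injective_mfderiv_symm x₀)).k
      ⟨y, hcB y hy⟩ v w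
    rw [InitialDataSet.comap_k, hmf (hcB y hy), hmf (hcB y hy)]
  have hHeq : ∀ y ∈ B, sliceMetric G =ᶠ[𝓝 y] D'.coordHOn := fun y hy ↦ by
    filter_upwards [hB.mem_nhds hy] with y' hy'
    exact hHpt y' hy'
  have hKeq : ∀ y ∈ B, sliceK G =ᶠ[𝓝 y] D'.coordKOn := fun y hy ↦ by
    filter_upwards [hB.mem_nhds hy] with y' hy'
    exact hKpt y' hy'
  -- the vacuum constraints of the slice data
  have hham : ∀ y ∈ B, hamAt (sliceMetric G) (sliceK G) y = 0 := fun y hy ↦ by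
    rw [hamAt_congr_of_eventuallyEq (hHeq y hy) (hKeq y hy)]
    exact (InitialDataSet.coordVacuum_comap_chart x₀ D hcons (stdBasis 3) (hcB y hy)).1
  have hmom : ∀ y ∈ B, ∀ Z, momFn (stdBasis 3) (sliceMetric G) (sliceK G) y Z = 0 := fun y hy Z ↦ by
    rw [momFn_congr_of_eventuallyEq (stdBasis 3) (hHeq y hy) (hKeq y hy)]
    exact (InitialDataSet.coordVacuum_comap_chart x₀ D hcons (stdBasis 3) (hcB y hy)).2 Z
  -- the coordinate theorem
  have hy₀ : c x₀ ∈ B := chart_mem_gcB₀ 𝒮 x₀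
  obtain ⟨ρs, hρs, hρsB, hcore⟩ :=
    GaussSlice.exists_coordKilling_of_kid hG hB hBT hS hRic hham hmom hpos hy₀
  -- an open set around the slice on which the Gaussian chart is injective
  have hΦc : ContMDiffOn 𝓘(ℝ, ℝ × E3) (𝓡 4) ∞ (gcΦext 𝒮 x₀ cs) T := contMDiffOn_gcΦext 𝒮 x₀ cs
  have hT : IsOpen T := hG.isOpen
  have hbij : ∀ p ∈ T, Bijective (mfderiv 𝓘(ℝ, ℝ × E3) (𝓡 4) (gcΦext 𝒮 x₀ cs) p) := fun p hp ↦
    ImmersionChart.bijective_mfderiv_ext (Φ := gcΦ 𝒮 x₀ cs) (injective_mfderiv_gcΦ 𝒮 x₀ cs)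
      finrank_prod_eq (fun _ ↦ rfl) hΦc hp
  set Ks : Set (ℝ × E3) := (fun y : E3 ↦ svec y) '' closedBall (c x₀) ρs with hKs_def
  have hKsc : IsCompact Ks := (isCompact_closedBall _ _).image (continuous_const.prodMk continuous_id)
  have hKsT : Ks ⊆ T := by
    rintro _ ⟨y, hy, rfl⟩
    exact hBT y (hρsB hy)
  have hinjK : InjOn (gcΦext 𝒮 x₀ cs) Ks := by
    rintro _ ⟨y₁, hy₁, rfl⟩ _ ⟨y₂, hy₂, rfl⟩ h
    rw [gcΦext_svec 𝒮 x₀ cs (hρsB hy₁), gcΦext_svec 𝒮 x₀ cs (hρsB hy₂)] at h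
    have h' := 𝒮.isSmoothEmbedding.isEmbedding.injective h
    have h'' : y₁ = y₂ := c.symm.injOn (hρsB hy₁).1 (hρsB hy₂).1 h'
    rw [h'']
  have hloc : ∀ p ∈ Ks, ∃ U ∈ 𝓝 p, InjOn (gcΦext 𝒮 x₀ cs) U := fun p hp ↦ by
    obtain ⟨Φd, hpΦ, heqΦ⟩ := Literature.Geometry.Manifold.isLocalDiffeomorphAt_of_bijective_mfderiv
      hT (hKsT hp) hΦc (hbij p (hKsT hp))
    exact ⟨Φd.source, Φd.open_source.mem_nhds hpΦ, fun a ha b hb hab ↦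
      Φd.injOn ha hb (by rw [← heqΦ ha, ← heqΦ hb]; exact hab)⟩
  obtain ⟨𝒩, h𝒩o, hKs𝒩, hinj𝒩⟩ := hinjK.exists_isOpen_superset hKsc
    (fun p hp ↦ (hΦc.continuousOn.continuousAt (hT.mem_nhds (hKsT hp)))) hloc
  -- the radius
  refine ⟨ρs, hρs, hρsB.trans fun y hy ↦ hy.1, fun ρ hρ hρle N Y hN hY hkid z hz ↦ ?_⟩
  have hballB : ball (c x₀) ρ ⊆ B :=
    (ball_subset_closedBall.trans (closedBall_subset_closedBall hρle)).trans hρsB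
  -- the KID equations for the slice data
  have hk1 : ∀ y ∈ ball (c x₀) ρ,
      adjHamK (sliceMetric G) (sliceK G) N y + adjMomKS (sliceMetric G) Y y = 0 := fun y hy ↦ by
    rw [adjHamK_congr_of_eventuallyEq (hHeq y (hballB hy)) (hKeq y (hballB hy)) EventuallyEq.rfl,
      adjMomKS_congr_of_eventuallyEq (hHeq y (hballB hy)) EventuallyEq.rfl]
    exact (hkid y hy).2
  have hk2 : ∀ y ∈ ball (c x₀) ρ, adjHamG (sliceMetric G) (sliceK G) N y +
      adjMomGS (sliceMetric G) (sliceK G) Y y = 0 := fun y hy ↦ by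
    rw [adjHamG_congr_of_eventuallyEq (hHeq y (hballB hy)) (hKeq y (hballB hy)) EventuallyEq.rfl,
      adjMomGS_congr_of_eventuallyEq (hHeq y (hballB hy)) (hKeq y (hballB hy)) EventuallyEq.rfl]
    exact (hkid y hy).1
  -- a slightly smaller ball containing `z`
  set ρ₁ : ℝ := (dist z (c x₀) + ρ) / 2 with hρ₁_def
  have hzρ : dist z (c x₀) < ρ := mem_ball.1 hz
  have hρ₁ρ : ρ₁ < ρ := by rw [hρ₁_def]; linarith
  have hzρ₁ : z ∈ ball (c x₀) ρ₁ := by rw [mem_ball, hρ₁_def]; linarith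
  have hρ₁pos : 0 < ρ₁ := by have := dist_nonneg (x := z) (y := c x₀); rw [hρ₁_def]; linarith
  have h𝒩slice : ∀ y ∈ ball (c x₀) ρ, svec y ∈ 𝒩 := fun y hy ↦
    hKs𝒩 ⟨y, (ball_subset_closedBall.trans (closedBall_subset_closedBall hρle)) hy, rfl⟩
  obtain ⟨W₀, hW₀o, hW₀T, hW₀𝒩, hsvecW₀, ξc, hξc, hkill, hzero⟩ :=
    hcore ρ hρ hρle N Y hN hY hk1 hk2 𝒩 h𝒩o h𝒩slice ρ₁ hρ₁ρ
  -- transport to a Killing field of `g` on `Φ(W₀)`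
  obtain ⟨ξ, hWopen, hξsm, hξkill, hξval⟩ :=
    ImmersionChart.exists_killing_of_coord 𝒮.metric.toPseudoRiemannianMetric (contMDiff_gcΦ 𝒮 x₀ cs)
      (injective_mfderiv_gcΦ 𝒮 x₀ cs) finrank_prod_eq hW₀o hW₀T (Φext := gcΦext 𝒮 x₀ cs)
      (fun _ ↦ rfl) hΦc (hinj𝒩.mono hW₀𝒩) hξc hkill
  -- the region `V = c⁻¹(ball ρ₁)` of the data manifold
  set V : Set X := c.symm '' ball (c x₀) ρ₁ with hV_def
  have hballt : ball (c x₀) ρ₁ ⊆ c.target := fun y hy ↦ (hballB (ball_subset_ball hρ₁ρ.le hy)).1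
  have hVo : IsOpen V := c.symm.isOpen_image_of_subset_source isOpen_ball hballt
  have hVc : IsConnected V :=
    ((convex_ball (c x₀) ρ₁).isConnected ⟨c x₀, mem_ball_self hρ₁pos⟩).image _
      (c.continuousOn_symm.mono hballt)
  have hx₀V : x₀ ∈ V := ⟨c x₀, mem_ball_self hρ₁pos, c.left_inv (mem_chart_source E3 x₀)⟩
  have hVW : 𝒟.embed '' V ⊆ gcΦext 𝒮 x₀ cs '' W₀ := by
    rintro _ ⟨_, ⟨y, hy, rfl⟩, rfl⟩
    refine ⟨svec y, hsvecW₀ y hy, ?_⟩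
    exact gcΦext_svec 𝒮 x₀ cs (hballB (ball_subset_ball hρ₁ρ.le hy))
  have hξ0 := hKID V hVo hVc hx₀V (gcΦext 𝒮 x₀ cs '' W₀) hWopen hVW ξ hξsm hξkill
  -- evaluate at `c⁻¹ z`
  have hzB : z ∈ B := hballB hz
  have h1 : ξ (𝒟.embed (c.symm z)) = 0 := hξ0 (c.symm z) ⟨z, hzρ₁, rfl⟩
  rw [← gcΦext_svec 𝒮 x₀ cs hzB] at h1
  rw [hξval (svec z) (hsvecW₀ z hzρ₁)] at h1
  have h2 : ξc (svec z) = 0 := by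
    have hinj := (hbij (svec z) (hBT z hzB)).1
    exact hinj (h1.trans (map_zero _).symm)
  exact hzero z hzρ₁ h2

/-- **`ChruscielDelay_localConstraintDeformation` from the analytic core `(A)` alone**: the
Moncrief half `(M)` of `ChruscielDelay_localConstraintDeformation_of_coordCore` is
`ChruscielDelay_noKID_of_noKilling`; what remains is the coordinate local surjectivity of the
constraint map at KID-free vacuum data with control of the kernel tangents (Chruściel–Delay 2003,
Thm. 5.9, Prop. 5.10, Cor. 5.11). [cite: ChruscielDelay2003, Thm. 5.9, Prop. 5.10 and Cor. 5.11] -/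
theorem ChruscielDelay_localConstraintDeformation_of_coordCoreA {ι : Type} [Fintype ι]
    (b₀ : Basis ι ℝ E3)
    (hA : ∀ (k : ℕ) (T : Set E3) (z₀ : E3) (ρ : ℝ), IsOpen T → 0 < ρ → closedBall z₀ ρ ⊆ T →
      ∀ (G K : E3 → E3 →L[ℝ] E3 →L[ℝ] ℝ), MetricCoord.IsMetricOn G T →
        (∀ z ∈ T, ∀ v : E3, v ≠ 0 → 0 < G z v v) →
        ContDiffOn ℝ ∞ K T → (∀ z ∈ T, ∀ v w : E3, K z v w = K z w v) →
        (∀ z ∈ T, MetricCoord.hamAt G K z = 0 ∧ ∀ Z : E3, MetricCoord.momFn b₀ G K z Z = 0) →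
        (∀ (N : E3 → ℝ) (Y : E3 → E3),
          ContDiffOn ℝ ∞ N (ball z₀ ρ) → ContDiffOn ℝ ∞ Y (ball z₀ ρ) →
          (∀ z ∈ ball z₀ ρ,
            MetricCoord.adjHamG G K N z + MetricCoord.adjMomGS G K Y z = 0 ∧
            MetricCoord.adjHamK G K N z + MetricCoord.adjMomKS G Y z = 0) →
          ∀ z ∈ ball z₀ ρ, N z = 0 ∧ Y z = 0) →
        ∀ (γ κ : Fin k → E3 → E3 →L[ℝ] E3 →L[ℝ] ℝ),
          (∀ j, ContDiffOn ℝ ∞ (γ j) T ∧ ContDiffOn ℝ ∞ (κ j) T ∧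
            (∀ z v w, γ j z v w = γ j z w v) ∧ (∀ z v w, κ j z v w = κ j z w v) ∧
            (∃ Kc : Set E3, IsCompact Kc ∧ Kc ⊆ ball z₀ ρ ∧ ∀ z, z ∉ Kc → γ j z = 0 ∧ κ j z = 0) ∧
            ∀ z ∈ T, MetricCoord.linHamFn b₀ G K (γ j) (κ j) z = 0 ∧
              ∀ Z : E3, MetricCoord.linMomFn b₀ G K (γ j) (κ j) z Z = 0) →
          ∃ (r : ℝ) (Gf Kf : EuclideanSpace ℝ (Fin k) → E3 → E3 →L[ℝ] E3 →L[ℝ] ℝ), 0 < r ∧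
            ContDiffOn ℝ ∞ (fun q : EuclideanSpace ℝ (Fin k) × E3 ↦ Gf q.1 q.2) (ball 0 r ×ˢ T) ∧
            ContDiffOn ℝ ∞ (fun q : EuclideanSpace ℝ (Fin k) × E3 ↦ Kf q.1 q.2) (ball 0 r ×ˢ T) ∧
            (∀ z ∈ T, Gf 0 z = G z ∧ Kf 0 z = K z) ∧
            (∀ c ∈ ball (0 : EuclideanSpace ℝ (Fin k)) r, ∀ z ∈ T, z ∉ closedBall z₀ ρ →
              Gf c z = G z ∧ Kf c z = K z) ∧
            (∀ c ∈ ball (0 : EuclideanSpace ℝ (Fin k)) r, ∀ z ∈ T, ∀ v w : E3,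
              Gf c z v w = Gf c z w v ∧ Kf c z v w = Kf c z w v) ∧
            (∀ c ∈ ball (0 : EuclideanSpace ℝ (Fin k)) r, ∀ z ∈ T,
              MetricCoord.hamAt (Gf c) (Kf c) z = 0 ∧
                ∀ Z : E3, MetricCoord.momFn b₀ (Gf c) (Kf c) z Z = 0) ∧
            ∀ j, ∀ z ∈ T, deriv (fun s : ℝ ↦ Gf (EuclideanSpace.single j s) z) 0 = γ j z ∧
              deriv (fun s : ℝ ↦ Kf (EuclideanSpace.single j s) z) 0 = κ j z) :
    ChruscielDelay_localConstraintDeformation :=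
  ChruscielDelay_localConstraintDeformation_of_coordCore b₀ ChruscielDelay_noKID_of_noKilling hA

end Literature.Geometry.Lorentzian

end
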